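import Summits.CriticalPhenomena.CardyFormulaZ2.Theorems.CardyComplexConeEdgePrecompactUFRSStrandsHpArmsPureFrames
import Literature.Probability.Percolation.ZdCrossingTranspose
import Literature.Probability.Percolation.KSTPeriodicArmDualityPlanar
import Literature.Probability.Percolation.DualContours

/-!
# Three strands of one completion ⇒ half-plane arms, VI: the four side frames of a box
(line `qkz-strip-boundary-arm` of crux `CardyComplexCone.EdgePrecompact`, stmt-CriticalPhenomena-11387;
concrete lattice frames for the registered sub-goal `ufrs_rect_strandsHpArms_pure`, HT-A pure case)

The framing lemma `frame_hpLooseArms_HTP` (`…UFRSStrandsHpArmsPureFrames.lean`) takes an abstract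
frame: a lattice automorphism `φ` on sites and one `ψ` on faces (lower-left corners) such that
`ψ` maps the edge separating two adjacent faces to the `φ`-image of their separating edge. This
file builds the four frames that put one side of the lattice box `[a₀, a₁] × [b₀, b₁]` onto the
row `0` with the box above it:

* bottom: translation by `(0, -b₀)` (faces likewise);
* top: `(u₀, u₁) ↦ (u₀, b₁ - u₁)` (faces `g ↦ (g₀, b₁ - 1 - g₁)`: an orientation-reversing map
  sends the square with lower-left corner `g` to the square with lower-left corner `φ g - e₁`);
* left: `(u₀, u₁) ↦ (u₁, u₀ - a₀)` (transposition; faces likewise);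
* right: `(u₀, u₁) ↦ (u₁, a₁ - u₀)` (faces `g ↦ (g₁, a₁ - 1 - g₀)`).

The separating-edge compatibility is checked for translations (`KSTPeriodic.sepEdge_add_right`),
the transposition (`sepEdge_transposeIso`) and the reflection `(u₀, u₁) ↦ (u₀, -u₁)` with face
map `g ↦ (g₀, -g₁ - 1)` (`compat_reflect_HTP`, registered anchor `ufrs_sepEdgeReflect`), and
composed (`compat_trans_HTP`).

References: G. Grimmett, *Percolation* (1999), §1.6 (lattice symmetries), §11.2 (planar duality).
-/

namespace Summit.CriticalPhenomena.CardyFormulaZ2.Cruxes.EdgePrecompact.QkzStripBoundaryArm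

open MeasureTheory Filter Set Metric Complex
open scoped Topology BigOperators Pointwise
open Literature.Probability.LatticeModels Literature.Probability.Percolation
open Literature.Probability.RandomPlanarGeometry (DobrushinDomain)
open Summit.CriticalPhenomena.CardyFormulaZ2.Theses.CardyComplexCone

noncomputable section

/-! ## Compatibility of site and face maps on separating edges -/

/-- Composition of lattice automorphisms acts as expected. -/
theorem iso_trans_apply_HTP (e₁ e₂ : zdGraph 2 ≃g zdGraph 2) (x : Site 2) : (e₁.trans e₂) x = e₂ (e₁ x) := rfl

/-- **Composition of compatible frames is compatible.** -/
theorem compat_trans_HTP (φ₁ ψ₁ φ₂ ψ₂ : zdGraph 2 ≃g zdGraph 2)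
    (h₁ : ∀ g g' : Site 2, (zdGraph 2).Adj g g' → sepEdge (ψ₁ g) (ψ₁ g') = Sym2.map φ₁ (sepEdge g g'))
    (h₂ : ∀ g g' : Site 2, (zdGraph 2).Adj g g' → sepEdge (ψ₂ g) (ψ₂ g') = Sym2.map φ₂ (sepEdge g g')) :
    ∀ g g' : Site 2, (zdGraph 2).Adj g g' →
      sepEdge ((ψ₁.trans ψ₂) g) ((ψ₁.trans ψ₂) g') = Sym2.map (φ₁.trans φ₂) (sepEdge g g') := by
  intro g g' h
  rw [iso_trans_apply_HTP, iso_trans_apply_HTP, h₂ _ _ (ψ₁.map_adj_iff.2 h), h₁ _ _ h, Sym2.map_map]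
  rfl

/-- **Translations are compatible** (with themselves as face maps). -/
theorem compat_shift_HTP (t : Site 2) : ∀ g g' : Site 2, (zdGraph 2).Adj g g' →
    sepEdge (zdShiftIso t g) (zdShiftIso t g') = Sym2.map (zdShiftIso t) (sepEdge g g') := by
  intro g g' _
  rw [zdShiftIso_apply, zdShiftIso_apply, KSTPeriodic.sepEdge_add_right]
  rfl

/-- **The transposition is compatible** (with itself as face map). -/
theorem compat_transpose_HTP : ∀ g g' : Site 2, (zdGraph 2).Adj g g' →
    sepEdge (transposeIso g) (transposeIso g') = Sym2.map transposeIso (sepEdge g g') :=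
  fun _ _ h => sepEdge_transposeIso h

/-- Coordinates of the reflection `(u₀, u₁) ↦ (u₀, -u₁)`. -/
theorem reflect1_apply_HTP (x : Site 2) : reflectIso 1 x 0 = x 0 ∧ reflectIso 1 x 1 = -x 1 :=
  ⟨reflectIso_apply_of_ne (by decide) x, reflectIso_apply_same 1 x⟩

/-- Coordinates of the face map `g ↦ (g₀, -g₁ - 1)` of the reflection. -/
theorem reflectFace_apply_HTP (x : Site 2) :
    ((reflectIso 1).trans (zdShiftIso (-(Pi.single 1 1)))) x 0 = x 0 ∧
      ((reflectIso 1).trans (zdShiftIso (-(Pi.single 1 1)))) x 1 = -x 1 - 1 := by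
  rw [iso_trans_apply_HTP, zdShiftIso_apply]
  obtain ⟨h0, h1⟩ := reflect1_apply_HTP x
  constructor
  · rw [Pi.add_apply, h0]; simp
  · rw [Pi.add_apply, h1]; simp [sub_eq_add_neg]

/-- **The reflection `(u₀, u₁) ↦ (u₀, -u₁)` with face map `g ↦ (g₀, -g₁ - 1)` is compatible**
(registered anchor `ufrs_sepEdgeReflect` of stmt-CriticalPhenomena-11387): the reflected square
with lower-left corner `g` has lower-left corner `(g₀, -g₁ - 1)`, and the edge separating two
reflected adjacent squares is the reflection of the separating edge. -/
theorem ufrs_sepEdgeReflect : ∀ g g' : Site 2, (zdGraph 2).Adj g g' → sepEdge (((reflectIso (1 : Fin 2)).trans (zdShiftIso (-(Pi.single 1 1)))) g) (((reflectIso (1 : Fin 2)).trans (zdShiftIso (-(Pi.single 1 1)))) g') = Sym2.map (reflectIso (1 : Fin 2)) (sepEdge g g') := by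
  intro g g' h
  set F : Site 2 → Site 2 := fun x => ((reflectIso (1 : Fin 2)).trans (zdShiftIso (-(Pi.single 1 1)))) x with hF
  have hF0 : ∀ x, F x 0 = x 0 := fun x => (reflectFace_apply_HTP x).1
  have hF1 : ∀ x, F x 1 = -x 1 - 1 := fun x => (reflectFace_apply_HTP x).2
  have hR0 : ∀ x : Site 2, reflectIso 1 x 0 = x 0 := fun x => (reflect1_apply_HTP x).1
  have hR1 : ∀ x : Site 2, reflectIso 1 x 1 = -x 1 := fun x => (reflect1_apply_HTP x).2
  show sepEdge (F g) (F g') = Sym2.map (reflectIso (1 : Fin 2)) (sepEdge g g')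
  rw [zdGraph_adj_iff, Fin.exists_fin_two] at h
  rcases h with (rfl | rfl) | (rfl | rfl)
  · -- `g' = g + e₀`
    have h1 : F (g + Pi.single 0 1) = F g + Pi.single 0 1 := by
      apply Contour.site_ext <;> simp [hF0, hF1]
    rw [h1, sepEdge_right, sepEdge_right, Sym2.map_mk, Sym2.eq_swap]
    congr 1 <;> apply Contour.site_ext <;> simp [hF0, hF1, hR0, hR1]
    all_goals omega
  · -- `g = g' + e₀`
    have h1 : F (g' + Pi.single 0 1) = F g' + Pi.single 0 1 := by
      apply Contour.site_ext <;> simp [hF0, hF1]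
    rw [sepEdge_comm, sepEdge_comm (g' + Pi.single 0 1), h1, sepEdge_right, sepEdge_right, Sym2.map_mk, Sym2.eq_swap]
    congr 1 <;> apply Contour.site_ext <;> simp [hF0, hF1, hR0, hR1]
    all_goals omega
  · -- `g' = g + e₁`
    have h1 : F g = F (g + Pi.single 1 1) + Pi.single 1 1 := by
      apply Contour.site_ext <;> simp [hF0, hF1]
      all_goals omega
    rw [sepEdge_comm, h1, sepEdge_up, ← h1, sepEdge_up, Sym2.map_mk]
    congr 1 <;> apply Contour.site_ext <;> simp [hF0, hF1, hR0, hR1]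
    all_goals omega
  · -- `g = g' + e₁`
    have h1 : F g' = F (g' + Pi.single 1 1) + Pi.single 1 1 := by
      apply Contour.site_ext <;> simp [hF0, hF1]
      all_goals omega
    rw [h1, sepEdge_up, ← h1, sepEdge_comm, sepEdge_up, Sym2.map_mk]
    congr 1 <;> apply Contour.site_ext <;> simp [hF0, hF1, hR0, hR1]
    all_goals omega

/-- `ufrs_sepEdgeReflect` in the format of `frame_hpLooseArms_HTP`. -/
theorem compat_reflect_HTP : ∀ g g' : Site 2, (zdGraph 2).Adj g g' →
    sepEdge (((reflectIso (1 : Fin 2)).trans (zdShiftIso (-(Pi.single 1 1)))) g)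
      (((reflectIso (1 : Fin 2)).trans (zdShiftIso (-(Pi.single 1 1)))) g') = Sym2.map (reflectIso (1 : Fin 2)) (sepEdge g g') :=
  ufrs_sepEdgeReflect

/-! ## The four side frames -/

/-- Frame of the bottom side `b₀`: translation by `(0, -b₀)`. -/
def frameB (b₀ : ℤ) : zdGraph 2 ≃g zdGraph 2 := zdShiftIso ![0, -b₀]

/-- Frame of the top side `b₁`: `(u₀, u₁) ↦ (u₀, b₁ - u₁)`. -/
def frameT (b₁ : ℤ) : zdGraph 2 ≃g zdGraph 2 := (reflectIso (1 : Fin 2)).trans (zdShiftIso ![0, b₁])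

/-- Face map of the top frame: `g ↦ (g₀, b₁ - 1 - g₁)`. -/
def faceT (b₁ : ℤ) : zdGraph 2 ≃g zdGraph 2 :=
  ((reflectIso (1 : Fin 2)).trans (zdShiftIso (-(Pi.single 1 1)))).trans (zdShiftIso ![0, b₁])

/-- Frame of the left side `a₀`: `(u₀, u₁) ↦ (u₁, u₀ - a₀)`. -/
def frameL (a₀ : ℤ) : zdGraph 2 ≃g zdGraph 2 := transposeIso.trans (zdShiftIso ![0, -a₀])

/-- Frame of the right side `a₁`: `(u₀, u₁) ↦ (u₁, a₁ - u₀)`. -/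
def frameR (a₁ : ℤ) : zdGraph 2 ≃g zdGraph 2 := transposeIso.trans ((reflectIso (1 : Fin 2)).trans (zdShiftIso ![0, a₁]))

/-- Face map of the right frame: `g ↦ (g₁, a₁ - 1 - g₀)`. -/
def faceR (a₁ : ℤ) : zdGraph 2 ≃g zdGraph 2 :=
  transposeIso.trans (((reflectIso (1 : Fin 2)).trans (zdShiftIso (-(Pi.single 1 1)))).trans (zdShiftIso ![0, a₁]))

/-- Coordinates of the bottom frame. -/
theorem frameB_apply (b₀ : ℤ) (u : Site 2) : frameB b₀ u 0 = u 0 ∧ frameB b₀ u 1 = u 1 - b₀ := by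
  simp [frameB, sub_eq_add_neg]

/-- Coordinates of the top frame. -/
theorem frameT_apply (b₁ : ℤ) (u : Site 2) : frameT b₁ u 0 = u 0 ∧ frameT b₁ u 1 = b₁ - u 1 := by
  rw [frameT, iso_trans_apply_HTP, zdShiftIso_apply, Pi.add_apply, Pi.add_apply, (reflect1_apply_HTP u).1,
    (reflect1_apply_HTP u).2]
  simp; ring

/-- Coordinates of the top face map. -/
theorem faceT_apply (b₁ : ℤ) (g : Site 2) : faceT b₁ g 0 = g 0 ∧ faceT b₁ g 1 = b₁ - 1 - g 1 := by
  rw [faceT, iso_trans_apply_HTP, zdShiftIso_apply, Pi.add_apply, Pi.add_apply, (reflectFace_apply_HTP g).1,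
    (reflectFace_apply_HTP g).2]
  simp; ring

/-- Coordinates of the left frame. -/
theorem frameL_apply (a₀ : ℤ) (u : Site 2) : frameL a₀ u 0 = u 1 ∧ frameL a₀ u 1 = u 0 - a₀ := by
  rw [frameL, iso_trans_apply_HTP, zdShiftIso_apply, Pi.add_apply, Pi.add_apply, transposeIso_apply_zero,
    transposeIso_apply_one]
  simp [sub_eq_add_neg]

/-- Coordinates of the right frame. -/
theorem frameR_apply (a₁ : ℤ) (u : Site 2) : frameR a₁ u 0 = u 1 ∧ frameR a₁ u 1 = a₁ - u 0 := by
  rw [frameR, iso_trans_apply_HTP, iso_trans_apply_HTP, zdShiftIso_apply, Pi.add_apply, Pi.add_apply,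
    (reflect1_apply_HTP _).1, (reflect1_apply_HTP _).2, transposeIso_apply_zero, transposeIso_apply_one]
  simp; ring

/-- Coordinates of the right face map. -/
theorem faceR_apply (a₁ : ℤ) (g : Site 2) : faceR a₁ g 0 = g 1 ∧ faceR a₁ g 1 = a₁ - 1 - g 0 := by
  rw [faceR, iso_trans_apply_HTP, iso_trans_apply_HTP, zdShiftIso_apply, Pi.add_apply, Pi.add_apply,
    (reflectFace_apply_HTP _).1, (reflectFace_apply_HTP _).2, transposeIso_apply_zero, transposeIso_apply_one]
  simp; ring

/-- Compatibility of the bottom frame (face map = site map). -/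
theorem compat_frameB (b₀ : ℤ) : ∀ g g' : Site 2, (zdGraph 2).Adj g g' →
    sepEdge (frameB b₀ g) (frameB b₀ g') = Sym2.map (frameB b₀) (sepEdge g g') :=
  compat_shift_HTP _

/-- Compatibility of the top frame with its face map. -/
theorem compat_frameT (b₁ : ℤ) : ∀ g g' : Site 2, (zdGraph 2).Adj g g' →
    sepEdge (faceT b₁ g) (faceT b₁ g') = Sym2.map (frameT b₁) (sepEdge g g') :=
  compat_trans_HTP _ _ _ _ compat_reflect_HTP (compat_shift_HTP _)

/-- Compatibility of the left frame (face map = site map). -/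
theorem compat_frameL (a₀ : ℤ) : ∀ g g' : Site 2, (zdGraph 2).Adj g g' →
    sepEdge (frameL a₀ g) (frameL a₀ g') = Sym2.map (frameL a₀) (sepEdge g g') :=
  compat_trans_HTP _ _ _ _ compat_transpose_HTP (compat_shift_HTP _)

/-- Compatibility of the right frame with its face map. -/
theorem compat_frameR (a₁ : ℤ) : ∀ g g' : Site 2, (zdGraph 2).Adj g g' →
    sepEdge (faceR a₁ g) (faceR a₁ g') = Sym2.map (frameR a₁) (sepEdge g g') :=
  compat_trans_HTP _ _ _ _ compat_transpose_HTP (compat_trans_HTP _ _ _ _ compat_reflect_HTP (compat_shift_HTP _))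

end

end Summit.CriticalPhenomena.CardyFormulaZ2.Cruxes.EdgePrecompact.QkzStripBoundaryArm
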